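import Summits.NavierStokesRegularity.NavierStokesRegularity.Theorems.PlanarFluxAPriori.Negative.FalseWithoutEnergyClass

/-!
# The fold-creation budget (`stub_foldCreationBudget`) is false without the energy-class hypotheses

Negative-side support for the crux `SlicedKelvin.PlanarFluxAPriori` (stmt-NavierStokesRegularity-15600, route
`SlicedKelvin`), line `registered` (skeleton `Cruxes/PlanarFluxAPriori/Lines/birth.lean`, rev 2), refuter
cdisprove seat, cycle 1 (2026-08-17). LOAD-BEARING ANALYSIS of the line's hardest stub: the registered stub
`stub_foldCreationBudget` (the Duhamel fold-creation functional
`D(u;R,t) = liminf_{ε→0⁺} ∫⁻_{τ∈(0,t)} (ν(t−τ))^{-1/2} ∫⁻_{ℝ³} (s_ε(u τ;R))⁺ dτ` is bounded over frames `R` and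
`t < T`) with its two energy-class hypotheses `IsLerayHopfOn T ν 0 (u 0) u` and `HasRapidSpatialDecay (u 0)`
DROPPED is FALSE (`foldCreationBudget_false_without_energyClass`; the weakened statement is written INLINE,
integrand verbatim).

Witness: the stationary linear flow `u(t,x) = (x₁ + x₂)(e₁ − e₂)`, `p = 0` — a nilpotent trace-free shear, hence
an entire classical Navier–Stokes solution for every viscosity
(`isClassicalNSSolutionOn_clm_of_sq_eq_zero`) — in the identity frame `R = 1` (plane normal `n = e₂`).
Its vorticity is the constant vector `−2e₀`, so `f = ω·n ≡ 0`: the fold term of the density vanishes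
(`∇f = 0`), but the ε-REGULARISATION TERM `−ε²·∂ₙuₙ/F_ε(f)` equals `−ε²·(−1)/ε = ε > 0` at EVERY point
(`∂₂u₂ = −1`, `F_ε(0) = ε`). Hence `∫⁻_{ℝ³} (s_ε)⁺ = ∫⁻_{ℝ³} ε = ⊤` for every `ε > 0`, the Duhamel integral
over `τ ∈ (0, ½)` is `⊤`, the `liminf` is `⊤`, and no `B : ℝ≥0` bounds it.

CONSEQUENCES for the line (what the provers should read off):
(i) the energy class is load-bearing for the budget stub exactly as for the crux (p150315), but through a
DIFFERENT term: not the flux itself (which is `0` here on planes `{x₂ = c}`!) but the ε-error term;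
(ii) the ε-regularisation term is not innocuous: `(−ε² ∂ₙuₙ/F_ε(f))⁺ ≤ ε (∂ₙuₙ)⁻` is only `O(ε)` in
`L¹(ℝ³)` if `∇u(τ) ∈ L¹(ℝ³)`, uniformly integrable against `(t−τ)^{-1/2} dτ`; the CUBIC decay
`(1+‖x‖)³‖Du‖ ≤ C` carried by the package stubs (`stub_decayPersistence`, `stub_foldLawPackage`) does NOT give
`∇u ∈ L¹(ℝ³)` (borderline-divergent), so `stub_foldCreationBudget` must use the true far-field decay of a
Navier–Stokes velocity from rapidly decaying data (`|∇u(τ,x)| ≲ |x|⁻⁵`, Brandolese–Vigneron / Kukavica–Torres)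
or the vanishing of `ω_n` must be exploited; with `f ≡ 0` on an open set the regularised density degenerates
to `−ε ∂ₙuₙ` there.
-/

noncomputable section

-- Problem = summit for this single-conjunct summit: the duplicate namespace component is deliberate.
set_option linter.dupNamespace false

namespace Summit.NavierStokesRegularity.NavierStokesRegularity.Theorems.PlanarFluxAPriori.Negative

open MeasureTheory Set Function Filter Literature.Analysis.FluidPDE
open scoped ENNReal InnerProductSpace Topology

/-- A `liminf` over `𝓝[>] 0` of a function that is `⊤` at every positive argument is `⊤`. [folklore] -/
theorem liminf_nhdsGT_eq_top_of_forall {g : ℝ → ℝ≥0∞} (hg : ∀ ε, 0 < ε → g ε = ⊤) :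
    Filter.liminf g (𝓝[>] (0 : ℝ)) = ⊤ := by
  have h : g =ᶠ[𝓝[>] (0 : ℝ)] fun _ => ⊤ := by
    filter_upwards [self_mem_nhdsWithin] with ε hε
    exact hg ε hε
  rw [Filter.liminf_congr h, Filter.liminf_const]

/-- **`stub_foldCreationBudget` is false without the energy-class hypotheses.** The registered stub of the
line `registered` of the crux `SlicedKelvin.PlanarFluxAPriori` with `IsLerayHopfOn T ν 0 (u 0) u` and
`HasRapidSpatialDecay (u 0)` dropped (statement inline, integrand verbatim) fails: for the nilpotent shear
`u = (x₁ + x₂)(e₁ − e₂)` (`ν = T = 1`, `R = 1`, `t = ½`) the vorticity is `−2e₀`, `f = ω₂ ≡ 0`, and the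
ε-regularised fold-creation density is the positive constant `ε`, whose integral over `ℝ³` is `⊤` for every
`ε > 0`; so the Duhamel fold-creation functional is `⊤ ≰ ↑B`. Hence every proof of the stub uses finite
energy / decay, and specifically integrability of `∇u(τ)` over `ℝ³`. [folklore] -/
theorem foldCreationBudget_false_without_energyClass :
    ¬ (∀ (ν T : ℝ), 0 < ν → 0 < T →
        ∀ (u : ℝ → EuclideanSpace ℝ (Fin 3) → EuclideanSpace ℝ (Fin 3)) (p : ℝ → EuclideanSpace ℝ (Fin 3) → ℝ),
        IsClassicalNSSolutionOn (Set.Ico 0 T) ν 0 u p →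
        ∃ B : NNReal, ∀ (R : EuclideanSpace ℝ (Fin 3) ≃ₗᵢ[ℝ] EuclideanSpace ℝ (Fin 3)), ∀ t ∈ Set.Ico 0 T,
          Filter.liminf (fun ε : ℝ => ∫⁻ τ in Set.Ioo 0 t, ENNReal.ofReal (1 / Real.sqrt (ν * (t - τ))) *
            (∫⁻ x : EuclideanSpace ℝ (Fin 3), ENNReal.ofReal
              (-(inner ℝ (u τ x) (R (EuclideanSpace.single 2 1))) *
                (ε ^ 2 / Real.sqrt (inner ℝ (curl (u τ) x) (R (EuclideanSpace.single 2 1)) ^ 2 + ε ^ 2) ^ 3) *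
                (inner ℝ (curl (u τ) x) (R (EuclideanSpace.single 0 1)) *
                    fderiv ℝ (fun z => inner ℝ (curl (u τ) z) (R (EuclideanSpace.single 2 1))) x
                      (R (EuclideanSpace.single 0 1)) +
                  inner ℝ (curl (u τ) x) (R (EuclideanSpace.single 1 1)) *
                    fderiv ℝ (fun z => inner ℝ (curl (u τ) z) (R (EuclideanSpace.single 2 1))) x
                      (R (EuclideanSpace.single 1 1))) -
                ε ^ 2 * fderiv ℝ (fun z => inner ℝ (u τ z) (R (EuclideanSpace.single 2 1))) x
                  (R (EuclideanSpace.single 2 1)) /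
                  Real.sqrt (inner ℝ (curl (u τ) x) (R (EuclideanSpace.single 2 1)) ^ 2 + ε ^ 2))))
            (nhdsWithin 0 (Set.Ioi 0)) ≤ (B : ENNReal)) := by
  intro h
  -- the nilpotent trace-free shear `L x = (x₁ + x₂)(e₁ − e₂)`
  set d : EuclideanSpace ℝ (Fin 3) := EuclideanSpace.single (1 : Fin 3) (1 : ℝ) - EuclideanSpace.single 2 1
    with hd
  set L : EuclideanSpace ℝ (Fin 3) →L[ℝ] EuclideanSpace ℝ (Fin 3) :=
    ((EuclideanSpace.proj (1 : Fin 3) + EuclideanSpace.proj (2 : Fin 3) :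
      EuclideanSpace ℝ (Fin 3) →L[ℝ] ℝ)).smulRight d with hL
  have hLx : ∀ x : EuclideanSpace ℝ (Fin 3), L x = (x 1 + x 2) • d := fun x => rfl
  have hd0 : d 0 = 0 := by simp [hd]
  have hd1 : d 1 = 1 := by simp [hd]
  have hd2 : d 2 = -1 := by simp [hd]
  have hL2 : ∀ x, L (L x) = 0 := fun x => by
    rw [hLx, hLx, PiLp.smul_apply, PiLp.smul_apply, hd1, hd2]
    simp
  have hdiv : ∀ x, VectorCalculus.divergence (L : EuclideanSpace ℝ (Fin 3) → EuclideanSpace ℝ (Fin 3)) x = 0 :=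
    fun x => by
    rw [divergence_clm_apply, LinearMap.trace_eq_sum_inner _ (EuclideanSpace.basisFun (Fin 3) ℝ)]
    simp [Fin.sum_univ_three, hLx, EuclideanSpace.inner_single_left, hd1, hd2]
  -- its vorticity is the constant vector `-2 e₀`; in particular `f = ω₂ ≡ 0`
  have hcurl2 : ∀ x, inner ℝ (curl (L : EuclideanSpace ℝ (Fin 3) → EuclideanSpace ℝ (Fin 3)) x)
      (EuclideanSpace.single (2 : Fin 3) (1 : ℝ)) = 0 := fun x => by
    simp [curl, ContinuousLinearMap.fderiv, hLx, EuclideanSpace.inner_single_right, hd0, hd1, hd2]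
  -- `∂₂ u₂ = ⟪L e₂, e₂⟫ = -1`
  have hfd2 : ∀ x : EuclideanSpace ℝ (Fin 3),
      fderiv ℝ (fun z => inner ℝ (L z) (EuclideanSpace.single (2 : Fin 3) (1 : ℝ))) x
        (EuclideanSpace.single (2 : Fin 3) (1 : ℝ)) = -1 := fun x => by
    have hfun : (fun z => inner ℝ (L z) (EuclideanSpace.single (2 : Fin 3) (1 : ℝ))) =
        fun z => ((innerSL ℝ (EuclideanSpace.single (2 : Fin 3) (1 : ℝ))).comp L) z := by
      funext z
      simp [real_inner_comm]
    rw [hfun, ContinuousLinearMap.fderiv]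
    simp [hLx, EuclideanSpace.inner_single_left, hd2]
  obtain ⟨B, hB⟩ := h 1 1 one_pos one_pos (fun _ => (L : EuclideanSpace ℝ (Fin 3) → EuclideanSpace ℝ (Fin 3))) 0
    (isClassicalNSSolutionOn_clm_of_sq_eq_zero hL2 hdiv _ _)
  have hB' := hB (LinearIsometryEquiv.refl ℝ (EuclideanSpace ℝ (Fin 3))) (1 / 2) ⟨by norm_num, by norm_num⟩
  simp only [LinearIsometryEquiv.coe_refl, id_eq] at hB'
  rw [liminf_nhdsGT_eq_top_of_forall] at hB'
  · exact ENNReal.not_top_le_coe hB'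
  intro ε hε
  have hsq : Real.sqrt ((0 : ℝ) ^ 2 + ε ^ 2) = ε := by
    rw [zero_pow two_ne_zero, zero_add, Real.sqrt_sq hε.le]
  have h5 : ∀ a b c : ℝ, -a * (ε ^ 2 / ε ^ 3) * (b * 0 + c * 0) - ε ^ 2 * -1 / ε = ε := by
    intro a b c
    field_simp
    ring
  simp only [hcurl2, fderiv_const_apply, zero_apply, hfd2, hsq, h5]
  have h6 : (∫⁻ _ : EuclideanSpace ℝ (Fin 3), ENNReal.ofReal ε) = ⊤ := by
    rw [lintegral_const, measure_univ_of_isAddLeftInvariant]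
    exact ENNReal.mul_top (ENNReal.ofReal_pos.2 hε).ne'
  simp only [h6]
  have h7 : EqOn (fun τ : ℝ => ENNReal.ofReal (1 / Real.sqrt (1 * (1 / 2 - τ))) * ⊤) (fun _ => ⊤)
      (Set.Ioo (0 : ℝ) (1 / 2)) := by
    intro τ hτ
    have hpos : 0 < 1 / Real.sqrt (1 * (1 / 2 - τ)) := by
      have : 0 < 1 / 2 - τ := by linarith [hτ.2]
      positivity
    exact ENNReal.mul_top (ENNReal.ofReal_pos.2 hpos).ne'
  rw [setLIntegral_congr_fun measurableSet_Ioo h7, setLIntegral_const]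
  refine ENNReal.top_mul ?_
  rw [Real.volume_Ioo]
  norm_num

end Summit.NavierStokesRegularity.NavierStokesRegularity.Theorems.PlanarFluxAPriori.Negative

end
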